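import Mathlib.FieldTheory.Finite.Basic
import Mathlib.LinearAlgebra.Matrix.GeneralLinearGroup.Projective
import Mathlib.LinearAlgebra.Projectivization.PSL.PSL2
import HarnessLib

/-!
# Normal subgroups of `GL₂(F)` and perfect images: the group theory of ACC⁺ 2023, §7

Topic `NumberTheory/GaloisRepresentations`; theorems only (no definitions, no named facts);
Mathlib only. These are the purely group-theoretic steps printed in §7.1–7.2 of P. B. Allen,
F. Calegari, A. Caraiani, T. Gee, D. Helm, B. V. Le Hung, J. Newton, P. Scholze, R. Taylor and
J. A. Thorne, *Potential automorphy over CM fields*, Ann. of Math. (2) 197 (2023), 897–1113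
[AllenCalegariCaraianiGeeEtAl2023], on the proof line Lemma 7.1.4 → Lemma 7.1.6 → Lemma 7.1.8
→ Theorem 7.1.11 → Corollary 7.1.12 (potential automorphy of the compatible system of a non-CM
elliptic curve over a CM field; the tree's named fact
`Literature.NumberTheory.Automorphic.exists_isCMField_isTateAutomorphic`). Page locators refer
to the held text `lit:arxiv-1812.09999` (sequential numbering: Lemma 133 = Lemma 7.1.4,
Lemma 135 = Lemma 7.1.6, Lemma 137 = Lemma 7.1.8, Theorem 140 = Theorem 7.1.11,
Corollary 141 = Corollary 7.1.12 of the Annals version).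

* `le_map_of_commutator_eq_self` (`…_of_isMulCommutative_quotient`) — **proof of Lemma 7.1.6
  (2)**, p. 99: "`r̄(G_{F'}) = r̄(G_F) ⊇ SL₂(𝔽_l)` and so, because `SL₂(𝔽_l)` is perfect, we
  have that `r̄(G_{F'(ζ_l)}) ⊇ SL₂(𝔽_l)`": a perfect subgroup of `ρ(G)` lies in `ρ(N)` for
  every `N ⊇ [G, G]`, e.g. `N ⊴ G` with abelian quotient (`G_{F'(ζ_l)} ⊴ G_{F'}`).
* `le_ker_of_commutator_eq_self`, `eq_bot_of_commutator_eq_self_of_le_range`,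
  `subsingleton_of_surjective_of_commutator_eq_top`, `le_of_commutator_eq_self_of_le_sup` —
  **proof of Theorem 7.1.11**, pp. 104–105 (linear disjointness of `F^avoid` and `L₃`):
  "`Gal(M₁/(L₁ ∩ K)) ≅ Gal(M₁/L₁) × Gal(M₁/K)` … contains a unique copy of `SL₂(𝔽_l)`
  (because this latter group is perfect, and in particular admits no solvable quotient) … `H`
  maps surjectively to `Gal(K/ℚ)` … and so must contain the unique copy of `SL₂(𝔽_l)`": a
  perfect subgroup lies in the kernel of every map to an abelian group, is trivial inside the
  image of a soluble group, and lies in `H` as soon as it lies in `H B`, `H` normal, `B` soluble.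
* `le_of_commutator_eq_self_of_map_mk_le`, `mapGL_range_le_of_forall_exists_mk_eq` — **proof
  of Lemma 7.1.4**, p. 98: "the image of `r̄_λ(G_F)` in `PGL₂(𝒪_M/λ)` contains `SL₂(𝔽_l)/{±1}`
  … `l > 3` so that `SL₂(𝔽_l)` is perfect … `z` defines a homomorphism
  `SL₂(𝔽_l) → (𝒪_M/λ)ˣ/Z` which must be identically `1`. Thus `SL₂(𝔽_l)` is contained in the
  image of `r̄_λ`": a perfect `S ≤ GL_n(k)` whose image in `PGL_n(k)` lies in `H`'s lies in `H`.
* `toGL_range_le_or_le_center_of_normal` (`…_of_card`, `…_zmod`) — **proof of Lemma 7.1.8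
  (2)**, p. 100: "any normal subgroup of `GL₂(𝔽_l)` either contains `SL₂(𝔽_l)` or is
  central" = E. Artin, *Geometric Algebra* (1957), Ch. IV, Thm. 4.9 for `n = 2`, over any
  field with an element `a ≠ 0`, `a² ≠ 1` (false for `GL₂(𝔽₂) ⊵ 𝔄₃`, `GL₂(𝔽₃) ⊵ Q₈`).
* `eq_top_of_normal_of_forall_exists_det_eq` (`…_zmod`) — its use there: "`Δ` … is a normal
  subgroup of `GL₂(𝔽_l)` which surjects under the determinant map onto `𝔽_lˣ` … and so
  `Δ = GL₂(𝔽_l)`" (finite `F` of odd characteristic, `4 ≤ |F|`; `ZMod l`, `5 ≤ l`).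

## Proofs

Artin's theorem: `N ⊴ GL₂(F)`, `N' = N ∩ SL₂(F)`; the image of `N'` in the simple group
`PSL₂(F)` (Mathlib `Matrix.ProjectiveSpecialLinearGroup.rank_two_simple'`) is normal, hence
trivial or everything. If everything, `N' Z(SL₂) = SL₂`, so `SL₂ = [SL₂, SL₂] = [N' Z, N' Z] =
[N', N'] ≤ N'` (Mathlib `Matrix.SL2.commutator_eq_top`). If trivial, `[N, SL₂] ≤ N ∩ SL₂ ≤
Z(SL₂)` is central, whence `[[SL₂, SL₂], N] = 1` (three-subgroups lemma): `N` centralises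
`SL₂`, in particular every transvection, so `N` is scalar. The lifting lemma of Lemma 7.1.4 is
`S = [S, S] ≤ [H Z, H Z] = [H, H] ≤ H`, `Z` the scalars; the §7.2 step is the same modulo `H`
with a soluble `B` in place of `Z`. Nothing here is specific to Galois representations; the
file sits next to the Serre 1972 §2 files on subgroups of `GL₂(𝔽_p)` (`SerreProp18GL2Fp`
records that it works around the absence of this theorem of Artin).

## References

* [AllenCalegariCaraianiGeeEtAl2023] P. B. Allen et al., *Potential automorphy over CM fields*,
  Ann. of Math. (2) 197 (2023), 897–1113, doi:10.4007/annals.2023.197.3.2 — §7.1, proofs of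
  Lemmas 7.1.4, 7.1.6 (2), 7.1.8 (2); §7.2, proof of Thm. 7.1.11 (held text pp. 98–100, 104–105).
* E. Artin, *Geometric Algebra*, Interscience (1957), Ch. IV, Thm. 4.9 (as cited by Serre,
  Invent. Math. 15 (1972), §2.7; statement only).
-/

open Matrix Matrix.SpecialLinearGroup
open scoped MatrixGroups commutatorElement

namespace Literature.NumberTheory.GaloisRepresentations

/-! ### Commutators and central factors -/

section Commutator

variable {G M : Type*} [Group G] [Group M]

/-- Central factors do not change a commutator: for `z₁, z₂ ∈ Z(G)`,
`⁅y₁ z₁, y₂ z₂⁆ = ⁅y₁, y₂⁆`. [folklore] -/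
theorem commutatorElement_mul_eq_of_mem_center {y₁ y₂ z₁ z₂ : G}
    (hz₁ : z₁ ∈ Subgroup.center G) (hz₂ : z₂ ∈ Subgroup.center G) :
    ⁅y₁ * z₁, y₂ * z₂⁆ = ⁅y₁, y₂⁆ := by
  have hc₁ : ∀ g, Commute g z₁ := Subgroup.mem_center_iff.mp hz₁
  have hc₂ : ∀ g, Commute g z₂ := Subgroup.mem_center_iff.mp hz₂
  rw [commutatorElement_mul_left_eq_conj_mul, (hc₁ _).symm.commutator_eq,
    commutatorElement_mul_right_eq_mul_conj, (hc₂ _).commutator_eq]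
  simp

/-- Central factors do not change commutator subgroups: `⁅H₁ ⊔ Z(G), H₂ ⊔ Z(G)⁆ = ⁅H₁, H₂⁆`
for all subgroups `H₁, H₂` of a group `G`. [folklore] -/
theorem commutator_sup_center_eq (H₁ H₂ : Subgroup G) :
    ⁅H₁ ⊔ Subgroup.center G, H₂ ⊔ Subgroup.center G⁆ = ⁅H₁, H₂⁆ := by
  refine le_antisymm ?_ (Subgroup.commutator_mono le_sup_left le_sup_left)
  rw [Subgroup.commutator_le]
  intro g₁ hg₁ g₂ hg₂
  obtain ⟨y₁, hy₁, z₁, hz₁, rfl⟩ := Subgroup.mem_sup_of_normal_right.mp hg₁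
  obtain ⟨y₂, hy₂, z₂, hz₂, rfl⟩ := Subgroup.mem_sup_of_normal_right.mp hg₂
  rw [commutatorElement_mul_eq_of_mem_center hz₁ hz₂]
  exact Subgroup.commutator_mem_commutator hy₁ hy₂

/-- **ACC⁺ 2023, proof of Lemma 7.1.6 (2), group-theoretic content.** A perfect subgroup
`S = [S, S]` of the image `f(G)` of a homomorphism `f : G → M` lies in `f(N)` for every subgroup
`N ⊇ [G, G]`: `S = [S, S] ≤ [f(G), f(G)] = f([G, G]) ≤ f(N)`. In the paper `G = G_{F'}`,
`N = G_{F'(ζ_l)}`, `f = r̄`, `S = SL₂(𝔽_l)` ("because `SL₂(𝔽_l)` is perfect,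
`r̄(G_{F'(ζ_l)}) ⊇ SL₂(𝔽_l)`"). [cite: AllenCalegariCaraianiGeeEtAl2023, §7.1, proof of Lemma 7.1.6 (2)] -/
theorem le_map_of_commutator_eq_self (f : G →* M) {S : Subgroup M} (hS : ⁅S, S⁆ = S)
    {N : Subgroup G} (hN : commutator G ≤ N) (h : S ≤ f.range) : S ≤ N.map f :=
  calc S = ⁅S, S⁆ := hS.symm
    _ ≤ ⁅f.range, f.range⁆ := Subgroup.commutator_mono h h
    _ = (commutator G).map f := by
      rw [MonoidHom.range_eq_map, ← Subgroup.map_commutator, commutator_def]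
    _ ≤ N.map f := Subgroup.map_mono hN

/-- **ACC⁺ 2023, proof of Lemma 7.1.6 (2), as used** (`G_{F'(ζ_l)} ⊴ G_{F'}` has abelian
quotient `Gal(F'(ζ_l)/F') ↪ (ℤ/lℤ)ˣ`): a perfect subgroup of `f(G)` lies in `f(N)` whenever
`N ⊴ G` has commutative quotient. [cite: AllenCalegariCaraianiGeeEtAl2023, §7.1, proof of Lemma 7.1.6 (2)] -/
theorem le_map_of_commutator_eq_self_of_isMulCommutative_quotient (f : G →* M) {S : Subgroup M}
    (hS : ⁅S, S⁆ = S) (N : Subgroup G) [N.Normal] [IsMulCommutative (G ⧸ N)] (h : S ≤ f.range) :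
    S ≤ N.map f :=
  le_map_of_commutator_eq_self f hS
    (Subgroup.Normal.quotient_commutative_iff_commutator_le.mp ‹IsMulCommutative (G ⧸ N)›) h

end Commutator

/-! ### Perfect subgroups versus soluble ones (proof of Theorem 7.1.11) -/

section Solvable

variable {G M : Type*} [Group G] [Group M]

/-- A perfect subgroup lies in the kernel of every homomorphism to a commutative group; e.g. a
perfect subgroup of `GL_n` lies in `SL_n = ker det` (so `SL₂(𝔽_l)` is "the unique copy of
`SL₂(𝔽_l)`" inside `GL₂(𝔽_l)`). [folklore] -/
theorem le_ker_of_commutator_eq_self {A : Type*} [CommGroup A] (f : G →* A) {S : Subgroup G}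
    (hS : ⁅S, S⁆ = S) : S ≤ f.ker := by
  rw [← hS, Subgroup.commutator_le]
  intro g₁ _ g₂ _
  rw [MonoidHom.mem_ker, map_commutatorElement]
  exact (Commute.all _ _).commutator_eq

/-- A perfect subgroup contained in the image of a soluble group is trivial ("`SL₂(𝔽_l)` is
perfect, and in particular admits no solvable quotient", ACC⁺ 2023, p. 104): if `K` is soluble,
`f : K → G`, and `P = [P, P] ≤ f(K)`, then `P ≤ f(K⁽ⁿ⁾)` for every `n`, and `K⁽ⁿ⁾ = 1` for large
`n`. [cite: AllenCalegariCaraianiGeeEtAl2023, §7.2, proof of Theorem 7.1.11] -/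
theorem eq_bot_of_commutator_eq_self_of_le_range {K : Type*} [Group K] [IsSolvable K]
    (f : K →* G) {P : Subgroup G} (hP : ⁅P, P⁆ = P) (h : P ≤ f.range) : P = ⊥ := by
  obtain ⟨n, hn⟩ := IsSolvable.solvable (G := K)
  have key : ∀ m, P ≤ (derivedSeries K m).map f := by
    intro m
    induction m with
    | zero => simpa [MonoidHom.range_eq_map] using h
    | succ m ih =>
      rw [derivedSeries_succ, Subgroup.map_commutator, ← hP]
      exact Subgroup.commutator_mono ih ih
  simpa [hn] using key n

/-- A perfect group admits no non-trivial soluble quotient (ACC⁺ 2023, p. 104, of `SL₂(𝔽_l)`).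
[cite: AllenCalegariCaraianiGeeEtAl2023, §7.2, proof of Theorem 7.1.11] -/
theorem subsingleton_of_surjective_of_commutator_eq_top [IsSolvable M] (f : G →* M)
    (hf : Function.Surjective f) (hG : commutator G = ⊤) : Subsingleton M := by
  have htop : (⊤ : Subgroup M) = ⊥ := by
    refine eq_bot_of_commutator_eq_self_of_le_range (MonoidHom.id M) ?_
      (le_of_eq (MonoidHom.range_eq_top.mpr Function.surjective_id).symm)
    rw [← MonoidHom.range_eq_top.mpr hf, MonoidHom.range_eq_map, ← Subgroup.map_commutator,
      ← commutator_def, hG]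
  exact Subgroup.subsingleton_iff.mp (subsingleton_of_bot_eq_top htop.symm)

/-- **ACC⁺ 2023, proof of Theorem 7.1.11, group-theoretic content** (pp. 104–105): if
`H ⊴ G`, `B ≤ G` is soluble and `S = [S, S] ≤ H B`, then `S ≤ H` (modulo `H` the image of `S` is
a perfect subgroup of the image of `B`, hence trivial). Printed uses: `G = Gal(M₁/(L₁ ∩ K)) =
H × B` with `B = Gal(M₁/K)` soluble "contains a unique copy of `SL₂(𝔽_l)` (because this latter
group is perfect, and in particular admits no solvable quotient)"; and, for the normal subgroup
`H ⊴ Gal(M₁/ℚ)` generated by the inertia groups above `l`, "`H` maps surjectively to `Gal(K/ℚ)`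
… and so must contain the unique copy of `SL₂(𝔽_l)`".
[cite: AllenCalegariCaraianiGeeEtAl2023, §7.2, proof of Theorem 7.1.11] -/
theorem le_of_commutator_eq_self_of_le_sup {S H B : Subgroup G} [H.Normal] [IsSolvable B]
    (hS : ⁅S, S⁆ = S) (h : S ≤ H ⊔ B) : S ≤ H := by
  have hmap : S.map (QuotientGroup.mk' H) ≤ ((QuotientGroup.mk' H).comp B.subtype).range := by
    rw [MonoidHom.range_comp, Subgroup.range_subtype]
    refine (Subgroup.map_mono h).trans ?_
    rw [Subgroup.map_sup, (Subgroup.map_eq_bot_iff H).mpr (by rw [QuotientGroup.ker_mk']),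
      bot_sup_eq]
  have hbot := eq_bot_of_commutator_eq_self_of_le_range _
    (by rw [← Subgroup.map_commutator, hS]) hmap
  rwa [Subgroup.map_eq_bot_iff, QuotientGroup.ker_mk'] at hbot

end Solvable

/-! ### Lifting a perfect subgroup from `PGL_n` to `GL_n` (proof of Lemma 7.1.4) -/

section Projective

variable {n k : Type*} [Fintype n] [DecidableEq n] [CommRing k]

/-- **ACC⁺ 2023, proof of Lemma 7.1.4, group-theoretic content.** Let `S, H ≤ GL_n(k)` with `S`
perfect (`⁅S, S⁆ = S`). If the image of `S` in `PGL_n(k) = GL_n(k)/Z` (`Z` the scalars) is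
contained in the image of `H`, then `S ≤ H`: `S = [S, S] ≤ [H Z, H Z] = [H, H] ≤ H`. (The paper
phrases the same argument through the homomorphism `z : S → kˣ/(kˣ ∩ H)`, "which must be
identically `1`" as `S` is perfect.)
[cite: AllenCalegariCaraianiGeeEtAl2023, §7.1, proof of Lemma 7.1.4] -/
theorem le_of_commutator_eq_self_of_map_mk_le {S H : Subgroup (GL n k)} (hS : ⁅S, S⁆ = S)
    (h : S.map (ProjGenLinGroup.mk : GL n k →* PGL(n, k)) ≤ H.map ProjGenLinGroup.mk) :
    S ≤ H := by
  have h' : S ≤ H ⊔ Subgroup.center (GL n k) := by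
    have hle := Subgroup.map_le_iff_le_comap.mp h
    rwa [Subgroup.comap_map_eq, ProjGenLinGroup.ker_mk] at hle
  calc S = ⁅S, S⁆ := hS.symm
    _ ≤ ⁅H ⊔ Subgroup.center (GL n k), H ⊔ Subgroup.center (GL n k)⁆ :=
      Subgroup.commutator_mono h' h'
    _ = ⁅H, H⁆ := commutator_sup_center_eq H H
    _ ≤ H := Subgroup.commutator_le_self H

variable {F : Type*} [Field F] [Algebra F k]

/-- The image of `SL₂(F)` in `GL₂(k)` (`k` an `F`-algebra) is perfect as soon as `F` has an
element `a ≠ 0` with `a² ≠ 1` (e.g. `F = 𝔽_l`, `l > 3`), by Mathlib's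
`Matrix.SL2.commutator_eq_top`. [folklore] -/
theorem commutator_mapGL_range_eq_self (hF : ∃ a : F, a ≠ 0 ∧ a ^ 2 ≠ 1) :
    ⁅(mapGL k : SL(2, F) →* GL (Fin 2) k).range, (mapGL k : SL(2, F) →* GL (Fin 2) k).range⁆ =
      (mapGL k : SL(2, F) →* GL (Fin 2) k).range := by
  obtain ⟨a, ha, hasq⟩ := hF
  rw [MonoidHom.range_eq_map, ← Subgroup.map_commutator, ← commutator_def,
    SL2.commutator_eq_top ha hasq]

/-- **ACC⁺ 2023, proof of Lemma 7.1.4, as printed for `SL₂`.** Let `F` be a field with an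
element `a ≠ 0`, `a² ≠ 1` (so that `SL₂(F)` is perfect; every `𝔽_l` with `l > 3`), `k` an
`F`-algebra and `H ≤ GL₂(k)`. If for every `g ∈ SL₂(F)` the image of `H` contains an element
`z(g) g` with `z(g)` a scalar — i.e. the image of `H` in `PGL₂(k)` contains that of `SL₂(F)` —
then `H` contains the image of `SL₂(F)`.
[cite: AllenCalegariCaraianiGeeEtAl2023, §7.1, proof of Lemma 7.1.4] -/
theorem mapGL_range_le_of_forall_exists_mk_eq (hF : ∃ a : F, a ≠ 0 ∧ a ^ 2 ≠ 1)
    {H : Subgroup (GL (Fin 2) k)}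
    (h : ∀ g : SL(2, F), ∃ x ∈ H, ProjGenLinGroup.mk (mapGL k g) = ProjGenLinGroup.mk x) :
    (mapGL k : SL(2, F) →* GL (Fin 2) k).range ≤ H := by
  refine le_of_commutator_eq_self_of_map_mk_le (commutator_mapGL_range_eq_self hF) ?_
  rintro _ ⟨_, ⟨g, rfl⟩, rfl⟩
  obtain ⟨x, hx, hgx⟩ := h g
  exact ⟨x, hx, hgx.symm⟩

end Projective

/-! ### Artin's theorem: normal subgroups of `GL₂(F)` (proof of Lemma 7.1.8 (2)) -/

section Artin

variable {F : Type*} [Field F]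

/-- The image of `SL_n(R)` in `GL_n(R)` is the kernel of the determinant. [folklore] -/
theorem toGL_range_eq_det_ker {n : Type*} [Fintype n] [DecidableEq n] {R : Type*} [CommRing R] :
    (toGL : SpecialLinearGroup n R →* GL n R).range = (GeneralLinearGroup.det : GL n R →* Rˣ).ker := by
  ext g
  constructor
  · rintro ⟨g, rfl⟩
    simp
  · intro hg
    rw [MonoidHom.mem_ker, Units.ext_iff, GeneralLinearGroup.val_det_apply, Units.val_one] at hg
    exact ⟨⟨g.val, hg⟩, Units.ext rfl⟩

/-- A field with at least four elements has an element `a ≠ 0` with `a² ≠ 1` (a generator of the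
cyclic group `Fˣ`, of order `|F| - 1 ≥ 3`) — the hypothesis of Mathlib's
`Matrix.SL2.commutator_eq_top` and `Matrix.ProjectiveSpecialLinearGroup.rank_two_simple'`. [folklore] -/
theorem exists_ne_zero_and_sq_ne_one_of_card (hF : 4 ≤ Nat.card F) :
    ∃ a : F, a ≠ 0 ∧ a ^ 2 ≠ 1 := by
  have : Finite F := (Nat.card_pos_iff.1 (by omega)).2
  obtain ⟨x, hx⟩ : IsCyclic Fˣ := by infer_instance
  refine ⟨x, Units.ne_zero x, fun h ↦ ?_⟩
  grw [Nat.card_eq_card_units_add_one F, ← orderOf_eq_card_of_forall_mem_zpowers hx,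
    orderOf_le_of_pow_eq_one zero_lt_two (Units.ext <| by simpa using h)] at hF
  omega

/-- **Artin's theorem for `GL₂` = ACC⁺ 2023, proof of Lemma 7.1.8 (2), group-theoretic content:**
"any normal subgroup of `GL₂(𝔽_l)` either contains `SL₂(𝔽_l)` or is central". Precisely: let
`F` be a field with an element `a ≠ 0`, `a² ≠ 1` (i.e. `F ≠ 𝔽₂, 𝔽₃`) and `N ⊴ GL₂(F)`; then
either `N ⊇ SL₂(F)` or `N ≤ Z(GL₂(F))` (the scalars). (E. Artin, *Geometric Algebra*, Ch. IV,
Thm. 4.9, case `n = 2`; the hypothesis on `F` is needed: `𝔄₃ ⊴ GL₂(𝔽₂)`, `Q₈ ⊴ GL₂(𝔽₃)`.)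
[cite: AllenCalegariCaraianiGeeEtAl2023, §7.1, proof of Lemma 7.1.8 (2)] -/
theorem toGL_range_le_or_le_center_of_normal (hF : ∃ a : F, a ≠ 0 ∧ a ^ 2 ≠ 1)
    (N : Subgroup (GL (Fin 2) F)) [hN : N.Normal] :
    (toGL : SL(2, F) →* GL (Fin 2) F).range ≤ N ∨ N ≤ Subgroup.center (GL (Fin 2) F) := by
  obtain ⟨a, ha, hasq⟩ := id hF
  haveI : IsSimpleGroup PSL(2, F) := Matrix.ProjectiveSpecialLinearGroup.rank_two_simple' hF
  set ι : SL(2, F) →* GL (Fin 2) F := toGL with hι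
  set Z : Subgroup SL(2, F) := Subgroup.center SL(2, F) with hZ
  set N' : Subgroup SL(2, F) := N.comap ι with hN'
  -- `SL₂(F)` and its image are perfect
  have hS : ⁅ι.range, ι.range⁆ = ι.range := by
    rw [MonoidHom.range_eq_map, ← Subgroup.map_commutator, ← commutator_def,
      SL2.commutator_eq_top ha hasq]
  -- the image of `N' = N ∩ SL₂(F)` in the simple group `PSL₂(F)` is normal: trivial or everything
  have hmap : (N'.map (QuotientGroup.mk' Z)).Normal :=
    Subgroup.Normal.map inferInstance _ (QuotientGroup.mk'_surjective Z)
  rcases hmap.eq_bot_or_eq_top with h | h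
  · -- trivial image: `N' ≤ Z(SL₂)`, and then `N` is central
    right
    have hN'Z : N' ≤ Z := by
      rwa [Subgroup.map_eq_bot_iff, QuotientGroup.ker_mk'] at h
    -- `[N, SL₂] ≤ N ∩ SL₂ = N' ≤ Z(SL₂)`, which is central in `GL₂`
    have h1 : ⁅N, ι.range⁆ ≤ Subgroup.center (GL (Fin 2) F) := by
      rw [Subgroup.commutator_le]
      rintro g hg _ ⟨s, rfl⟩
      have hmem : ⁅g, ι s⁆ ∈ ι.range := by
        rw [toGL_range_eq_det_ker, MonoidHom.mem_ker, map_commutatorElement]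
        exact (Commute.all _ _).commutator_eq
      obtain ⟨x, hx⟩ := hmem
      have hxN : ι x ∈ N := by
        rw [hx, commutatorElement_def, mul_assoc, mul_assoc]
        exact N.mul_mem hg (by simpa only [mul_assoc] using hN.conj_mem _ (N.inv_mem hg) (ι s))
      rw [← hx]
      exact (toGL_mem_center_iff x).mpr (hN'Z (Subgroup.mem_comap.mpr hxN))
    -- three-subgroups lemma: `[[SL₂, SL₂], N] = 1`
    have h2 : ⁅⁅ι.range, ι.range⁆, N⁆ = ⊥ := by
      refine Subgroup.commutator_commutator_eq_bot_of_rotate ?_ ?_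
      · rw [Subgroup.commutator_eq_bot_iff_le_centralizer]
        have h1' : ⁅ι.range, N⁆ ≤ Subgroup.center (GL (Fin 2) F) := by
          rwa [Subgroup.commutator_comm] at h1
        exact h1'.trans (Subgroup.center_le_centralizer _)
      · rw [Subgroup.commutator_eq_bot_iff_le_centralizer]
        exact h1.trans (Subgroup.center_le_centralizer _)
    rw [hS, Subgroup.commutator_eq_bot_iff_le_centralizer] at h2
    -- so `N` commutes with every transvection, hence is scalar
    intro g hg
    rw [GeneralLinearGroup.mem_center_iff_val_mem_range_scalar]
    refine mem_range_scalar_of_commute_transvectionStruct fun t => ?_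
    have ht : ι t.toSpecialLinearGroup ∈ Subgroup.centralizer (N : Set (GL (Fin 2) F)) :=
      h2 ⟨t.toSpecialLinearGroup, rfl⟩
    have key := congrArg (fun u : GL (Fin 2) F => (u : Matrix (Fin 2) (Fin 2) F))
      (Subgroup.mem_centralizer_iff.mp ht g hg)
    simp only [Units.val_mul] at key
    exact key.symm
  · -- full image: `N' Z(SL₂) = SL₂`, so `SL₂ = [SL₂, SL₂] = [N', N'] ≤ N'`
    left
    have hsup : N' ⊔ Z = ⊤ := by
      have hc := congrArg (Subgroup.comap (QuotientGroup.mk' Z)) h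
      simpa [Subgroup.comap_map_eq, QuotientGroup.ker_mk'] using hc
    have hN'top : N' = ⊤ := by
      refine top_le_iff.mp ?_
      calc (⊤ : Subgroup SL(2, F)) = commutator SL(2, F) := (SL2.commutator_eq_top ha hasq).symm
        _ = ⁅N' ⊔ Z, N' ⊔ Z⁆ := by rw [commutator_def, hsup]
        _ = ⁅N', N'⁆ := commutator_sup_center_eq N' N'
        _ ≤ N' := Subgroup.commutator_le_self N'
    rintro _ ⟨s, rfl⟩
    have hs : s ∈ N' := hN'top ▸ Subgroup.mem_top s
    exact Subgroup.mem_comap.mp hs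

/-- Artin's theorem for `GL₂` over a field with at least four elements (e.g. any finite field
other than `𝔽₂`, `𝔽₃`): a normal subgroup of `GL₂(F)` contains `SL₂(F)` or is central.
[cite: AllenCalegariCaraianiGeeEtAl2023, §7.1, proof of Lemma 7.1.8 (2)] -/
theorem toGL_range_le_or_le_center_of_normal_of_card (hF : 4 ≤ Nat.card F)
    (N : Subgroup (GL (Fin 2) F)) [N.Normal] :
    (toGL : SL(2, F) →* GL (Fin 2) F).range ≤ N ∨ N ≤ Subgroup.center (GL (Fin 2) F) :=
  toGL_range_le_or_le_center_of_normal (exists_ne_zero_and_sq_ne_one_of_card hF) N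

/-- Artin's theorem for `GL₂(𝔽_l)`, `l ≥ 5` prime, verbatim the sentence of ACC⁺ 2023, p. 100:
"any normal subgroup of `GL₂(𝔽_l)` either contains `SL₂(𝔽_l)` or is central".
[cite: AllenCalegariCaraianiGeeEtAl2023, §7.1, proof of Lemma 7.1.8 (2)] -/
theorem toGL_range_le_or_le_center_of_normal_zmod {l : ℕ} [Fact l.Prime] (hl : 5 ≤ l)
    (N : Subgroup (GL (Fin 2) (ZMod l))) [N.Normal] :
    (toGL : SL(2, ZMod l) →* GL (Fin 2) (ZMod l)).range ≤ N ∨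
      N ≤ Subgroup.center (GL (Fin 2) (ZMod l)) :=
  toGL_range_le_or_le_center_of_normal_of_card (by rw [Nat.card_zmod]; omega) N

/-- **ACC⁺ 2023, proof of Lemma 7.1.8 (2), the conclusion drawn:** over a finite field `F` of odd
characteristic with `4 ≤ |F|`, a normal subgroup `Δ ⊴ GL₂(F)` which surjects onto `Fˣ` under the
determinant is all of `GL₂(F)`. (By Artin's theorem `Δ ⊇ SL₂(F) = ker det`, whence
`Δ = GL₂(F)`; or `Δ` is scalar, but then `det Δ` consists of squares, and `Fˣ` has non-squares
in odd characteristic.) [cite: AllenCalegariCaraianiGeeEtAl2023, §7.1, proof of Lemma 7.1.8 (2)] -/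
theorem eq_top_of_normal_of_forall_exists_det_eq [Finite F] (h2 : ringChar F ≠ 2)
    (hF : 4 ≤ Nat.card F) (N : Subgroup (GL (Fin 2) F)) [N.Normal]
    (hdet : ∀ u : Fˣ, ∃ g ∈ N, GeneralLinearGroup.det g = u) : N = ⊤ := by
  rcases toGL_range_le_or_le_center_of_normal_of_card hF N with h | h
  · rw [eq_top_iff]
    intro g _
    obtain ⟨d, hd, hdg⟩ := hdet (GeneralLinearGroup.det g)
    have hgd : g * d⁻¹ ∈ N := by
      refine h ?_
      rw [toGL_range_eq_det_ker, MonoidHom.mem_ker, map_mul, map_inv, hdg, mul_inv_cancel]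
    simpa using N.mul_mem hgd hd
  · exfalso
    obtain ⟨a, ha⟩ := FiniteField.exists_nonsquare h2
    have ha0 : a ≠ 0 := fun h0 => ha (h0 ▸ IsSquare.zero)
    obtain ⟨g, hg, hga⟩ := hdet (Units.mk0 a ha0)
    have hgZ := h hg
    rw [GeneralLinearGroup.center_eq_range_scalar] at hgZ
    obtain ⟨r, rfl⟩ := hgZ
    rw [GeneralLinearGroup.det_scalar, Fintype.card_fin, Units.ext_iff] at hga
    exact ha ⟨r, by simpa [pow_two] using hga.symm⟩

/-- The same over `𝔽_l = ZMod l`, `l ≥ 5` prime, verbatim the step of ACC⁺ 2023, p. 100: "`Δ` …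
is a normal subgroup of `GL₂(𝔽_l)` which surjects under the determinant map onto `𝔽_lˣ` … and
so `Δ = GL₂(𝔽_l)`". [cite: AllenCalegariCaraianiGeeEtAl2023, §7.1, proof of Lemma 7.1.8 (2)] -/
theorem eq_top_of_normal_of_forall_exists_det_eq_zmod {l : ℕ} [Fact l.Prime] (hl : 5 ≤ l)
    (N : Subgroup (GL (Fin 2) (ZMod l))) [N.Normal]
    (hdet : ∀ u : (ZMod l)ˣ, ∃ g ∈ N, GeneralLinearGroup.det g = u) : N = ⊤ :=
  eq_top_of_normal_of_forall_exists_det_eq (by rw [ZMod.ringChar_zmod_n]; omega)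
    (by rw [Nat.card_zmod]; omega) N hdet

end Artin

/-- **ACC⁺ 2023, proof of Theorem 7.1.11, p. 104: "As `Gal(L₁/ℚ)` is soluble, we see that
`L₁ ∩ K ⊂ ℚ(ζ_l)`"** (`K = ℚ̄^{ker r̄_{E,l}}`, `Gal(K/ℚ) = GL₂(𝔽_l)`, `K^{SL₂(𝔽_l)} = ℚ(ζ_l)`),
group-theoretic content: a perfect subgroup `S = [S, S]` lies in every normal subgroup `N` with
soluble quotient `G ⧸ N` (the image of `S` in `G ⧸ N` is perfect, hence trivial); there
`N = Gal(K/(L₁ ∩ K))`, whose quotient `Gal((L₁ ∩ K)/ℚ)` is a quotient of the soluble `Gal(L₁/ℚ)`,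
and `S = SL₂(𝔽_l)`. [cite: AllenCalegariCaraianiGeeEtAl2023, §7.2, proof of Theorem 7.1.11] -/
theorem le_of_commutator_eq_self_of_isSolvable_quotient {G : Type*} [Group G] {S : Subgroup G}
    (hS : ⁅S, S⁆ = S) (N : Subgroup G) [N.Normal] [IsSolvable (G ⧸ N)] : S ≤ N := by
  have hbot := eq_bot_of_commutator_eq_self_of_le_range (MonoidHom.id (G ⧸ N))
    (P := S.map (QuotientGroup.mk' N)) (by rw [← Subgroup.map_commutator, hS])
    (by rw [MonoidHom.range_eq_top.mpr Function.surjective_id]; exact le_top)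
  rwa [Subgroup.map_eq_bot_iff, QuotientGroup.ker_mk'] at hbot

end Literature.NumberTheory.GaloisRepresentations
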